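import Mathlib
import HarnessLib
import Summits.ResolutionOfSingularities.ResolutionOfSingularities.Theorems.WildQuotientsWildQuotientResolutionToricExitTransferOneTwo
import Summits.ResolutionOfSingularities.ResolutionOfSingularities.Theorems.WildQuotientsWildQuotientResolutionJordanThreeTwoChartsStable
import Summits.ResolutionOfSingularities.ResolutionOfSingularities.Theorems.WildQuotientsWildQuotientResolutionToricExitJordanThreeBrickNonempty
import Summits.ResolutionOfSingularities.ResolutionOfSingularities.Theorems.WildQuotientsWildQuotientResolutionJordanThreeTwoCentre
import Summits.ResolutionOfSingularities.ResolutionOfSingularities.Theorems.WildQuotientsWildQuotientResolutionJordanThreeOrder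
import Summits.ResolutionOfSingularities.ResolutionOfSingularities.Theorems.WildQuotientsWildQuotientResolutionToricExitCover
import Summits.ResolutionOfSingularities.ResolutionOfSingularities.Theorems.WildQuotientsWildQuotientResolutionToricExitChartStable
import Summits.ResolutionOfSingularities.ResolutionOfSingularities.Theorems.WildQuotientsWildQuotientResolutionAffineQuotientData
import Summits.ResolutionOfSingularities.ResolutionOfSingularities.Theorems.WildQuotientsWildQuotientResolutionAffineQuotientEtale
import Summits.ResolutionOfSingularities.ResolutionOfSingularities.Theorems.WildQuotientsWildQuotientResolutionLinearSmallBlocksAlgebra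
import Summits.ResolutionOfSingularities.ResolutionOfSingularities.Theorems.WildQuotientsWildQuotientResolutionFixedPointsRegular
import Summits.ResolutionOfSingularities.ResolutionOfSingularities.Theorems.WildQuotientsGaloisQuotientStableCover
import Literature.AlgebraicGeometry.Resolution.BlowupPrincipalCharts
import Literature.AlgebraicGeometry.Resolution.BlowupsEquivariant
import Summits.ResolutionOfSingularities.ResolutionOfSingularities.Theorems.WildQuotientsWildQuotientResolutionFixedPointsGraded

/-!
# N4a: the `J₃ ⊕ J₂` toric exit, assembled modulo its bricks
(crux stmt-ResolutionOfSingularities-15640 `WildQuotients.WildQuotientResolution`, line `Sketch`;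
chain w45c post-V5 width target N4a `JordanThreeTwo.jordanThreeTwo_hasResolution`
(res-L1-w45c-stub-2 SIG 2026-08-27T14:24:14Z, res-L1-w45c-plan-1 NO OBJECTION 14:24:34Z / 15:17:58Z
«stub-2 g5 = N4a PART F», CHAIN v9 §4), part (F2) of res-L1-w45c-stub-2's file plan 15:17:44Z; the
`J₃ ⊕ J₂` twin of `ToricExit.jordanThree_hasResolution_of_bricks` (p496627). [OURS · L1 W4.5c] —
NOT a statement of any manuscript; replaces the role of no printed item. Def-free.)

`JordanThreeTwo.jordanThreeTwo_hasResolution_of_bricks`: for the `J₃ ⊕ J₂` datum (`σ x_b = x_b + x_a`,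
`σ x_c = x_c + x_b`, `σ x_e = x_e + x_d`, every other variable fixed) over a field of characteristic
`p ≥ 3`, `Spec k[x]^⟨σ⟩` has a resolution of singularities PROVIDED the bricks of the three-piece
toric exit hold for `V = Bl_I 𝔸ⁿ`, `I = (x_a, x_b², x_bx_d, x_d²)` (spelling of record
`Ideal.span (Set.range ![X a, X b ^ 2, X b * X d, X d ^ 2])`) with the lifted action
(`IsBlowup.liftAction ρ hJ`, `hJ` ABSTRACT — discharged by `JordanThreeTwo.idealSheaf_I4_comap`,
p544068) and its principal charts `V[x_a]`, `V[x_b²]`, `V[x_d²]` (Literature `blowupChart`):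

* `Hregb`/`Hregd` — the points of the charts `V[x_b²]`, `V[x_d²]` have regular local rings
  (res-L1-w45c-stub-3, `…JordanThreeTwoChartsKL`);
* `Hdivb`/`Hdivd` — at every fixed point of `V[x_b²]`, resp. `V[x_d²]`, the stalk augmentation ideal
  of the lifted action is principal (res-L1-w45c-stub-3
  `JordanThreeTwo.isPrincipal_stalkAug_liftAction_of_mem_blowupChart`, p544113, `i = 1`, `i = 3`);
* `HPa` — THE CONE BRICK: every blow-up of the quotient piece `V[x_a]/G` along the ideal sheaf of
  the image of the vertex locus `T_a = π⁻¹V(x_a, x_b, x_d) ∖ ⋃_{j ≠ 0} V[gens j]` is regular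
  (`V[x_a]/G ≅ ½(1,1,1) × 𝔸ⁿ⁻³`, `Half111.blowup_regular`; shape of
  `BlowupExit.exists_isBlowup_regular_of_vertexPresentation`, `F₀ = {X a, X b, X d}`,
  `κ = {j // j ≠ 0}`).

Everything else is discharged here: the crux data of `𝔸ⁿ → 𝔸ⁿ/⟨σ⟩` (`AffineQuotient.*`, order
`p` by `JordanThreeTwo.pow_prime_eq_one` + `JordanThree.ne_one`, generic étaleness over `D(x_a)`),
the model (`JordanThreeTwo.I4_blowup_integral_proper_birational`), the `G`-stability of `V[x_a]`
and `V[x_d²]` (`JordanThreeTwo.preimage_chart_a_eq` / `preimage_chart_dsq_eq`, `…ChartsStable`), the stable affine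
piece `Ob = ⋂ g·V[x_b²]` (`ToricExit.exists_stable_affine_cover_pair` with `A = V[x_a] ⊔ V[x_d²]`),
the cover (`JordanThreeTwo.chart_a_sup_chart_bsq_sup_chart_dsq_eq_top`), non-emptiness of
`Ob`, `Od` (`BlowupExit.nonempty_iInf_preimage_of_irreducibleSpace`, `affineBlowup_blowupChart_nonempty`,
p498242), the topology of `T_a`, and the `1 + 2`-piece exit `ToricExit.toricExitTransfer₁₂` (p544819).
-/

-- single-problem summit: the doubled namespace component `ResolutionOfSingularities` is forced
set_option linter.dupNamespace false

noncomputable section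

open CategoryTheory AlgebraicGeometry TopologicalSpace MvPolynomial
open Literature.AlgebraicGeometry.Resolution Literature.AlgebraicGeometry.RelativeSpec

namespace Summit.ResolutionOfSingularities.ResolutionOfSingularities.Theorems.WildQuotientResolution.JordanThreeTwo

section Scaffold

variable (k : Type) [Field k] (n : ℕ) (a b d : Fin n)

/-- The generator vector of record (local shorthand). -/
local notation3 "g4" => (![X a, X b ^ 2, X b * X d, X d ^ 2] : Fin 4 → MvPolynomial (Fin n) k)
/-- The centre `I = (x_a, x_b², x_bx_d, x_d²)` (local shorthand). -/
local notation3 "I4" => Ideal.span (Set.range g4)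
/-- `k[x] → Γ(Spec k[x], ⊤)` (local shorthand). -/
local notation3 "ι₀" => (Scheme.ΓSpecIso (CommRingCat.of (MvPolynomial (Fin n) k))).inv.hom
/-- The cone chart `V[x_a]` of `V = Bl_I 𝔸ⁿ` (local shorthand). -/
local notation3 "VchA" => blowupChart (affineBlowup.π I4) (affineBlowup.idealSheaf I4)
  ⟨⊤, isAffineOpen_top _⟩ (ι₀ (X a))
/-- The K–L chart `V[x_b²]` of `V = Bl_I 𝔸ⁿ` (local shorthand). -/
local notation3 "VchB" => blowupChart (affineBlowup.π I4) (affineBlowup.idealSheaf I4)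
  ⟨⊤, isAffineOpen_top _⟩ (ι₀ (X b ^ 2))
/-- The K–L chart `V[x_d²]` of `V = Bl_I 𝔸ⁿ` (local shorthand). -/
local notation3 "VchD" => blowupChart (affineBlowup.π I4) (affineBlowup.idealSheaf I4)
  ⟨⊤, isAffineOpen_top _⟩ (ι₀ (X d ^ 2))
/-- The vertex locus `T_a = π⁻¹V(x_a, x_b, x_d) ∖ ⋃_{j ≠ 0} V[gens j]` (local shorthand). -/
local notation3 "Ta" => ({v : ↥(affineBlowup I4) | (affineBlowup.π I4).base v ∈
      PrimeSpectrum.zeroLocus ({X a, X b, X d} : Set (MvPolynomial (Fin n) k))} \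
    ((⨆ j : {j : Fin 4 // j ≠ 0}, blowupChart (affineBlowup.π I4) (affineBlowup.idealSheaf I4)
      ⟨⊤, isAffineOpen_top _⟩ (ι₀ (g4 j.1)) : (affineBlowup I4).Opens) : Set ↥(affineBlowup I4)))
/-- The quotient map `𝔸ⁿ → 𝔸ⁿ/⟨σ⟩` (local shorthand). -/
local notation3 "qσ" σ' => Spec.map (CommRingCat.ofHom (algebraMap
  (FixedPoints.subalgebra k (MvPolynomial (Fin n) k) (Subgroup.zpowers σ')) (MvPolynomial (Fin n) k)))

-- the glued-quotient / blow-up bookkeeping is individually cheap but numerous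
set_option maxHeartbeats 1600000 in
/-- **The `J₃ ⊕ J₂` toric exit modulo its bricks** (see the module docstring for the bricks
`Hregb`, `Hregd`, `Hdivb`, `Hdivd`, `HPa`). [OURS · L1 W4.5c]
[folklore; assembly of landed decls] -/
theorem jordanThreeTwo_hasResolution_of_bricks (p : ℕ) (hp : p.Prime) (hp3 : 3 ≤ p) [CharP k p]
    (σ : MvPolynomial (Fin n) k ≃ₐ[k] MvPolynomial (Fin n) k) [Finite ↥(Subgroup.zpowers σ)]
    (c e : Fin n) (hab : a ≠ b) (hac : a ≠ c) (hae : a ≠ e) (hbd : b ≠ d) (hcd : c ≠ d)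
    (hde : d ≠ e)
    (hb : σ (X b) = X b + X a) (hc : σ (X c) = X c + X b) (he : σ (X e) = X e + X d)
    (hσ : ∀ i, i ≠ b → i ≠ c → i ≠ e → σ (X i) = X i)
    (Hregb : ∀ v ∈ VchB, IsRegularLocalRing ((affineBlowup I4).presheaf.stalk v))
    (Hregd : ∀ v ∈ VchD, IsRegularLocalRing ((affineBlowup I4).presheaf.stalk v))
    (Hdivb : ∀ (ρ : ↥(Subgroup.zpowers σ) →* Aut (Spec (CommRingCat.of (MvPolynomial (Fin n) k))))
      (_ : (∀ g : ↥(Subgroup.zpowers σ), (ρ g).hom = Spec.map (CommRingCat.ofHom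
        ((MulSemiringAction.toRingEquiv (↥(Subgroup.zpowers σ)) (MvPolynomial (Fin n) k) g⁻¹ :
          MvPolynomial (Fin n) k ≃+* MvPolynomial (Fin n) k) :
            MvPolynomial (Fin n) k →+* MvPolynomial (Fin n) k))))
      (hJ : (∀ g : ↥(Subgroup.zpowers σ),
        (affineBlowup.idealSheaf I4).comap (ρ g).hom = affineBlowup.idealSheaf I4)) (g : ↥(Subgroup.zpowers σ)) (v : ↥(affineBlowup I4))
      (hv : (((affineBlowup.isBlowup I4).liftAction ρ hJ) g).hom.base v = v), v ∈ VchB →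
      (Ideal.span (Set.range fun s =>
        ((affineBlowup I4).presheaf.stalkSpecializes (specializes_of_eq hv) ≫
          (((affineBlowup.isBlowup I4).liftAction ρ hJ) g).hom.stalkMap v).hom s - s)).IsPrincipal)
    (Hdivd : ∀ (ρ : ↥(Subgroup.zpowers σ) →* Aut (Spec (CommRingCat.of (MvPolynomial (Fin n) k))))
      (_ : (∀ g : ↥(Subgroup.zpowers σ), (ρ g).hom = Spec.map (CommRingCat.ofHom
        ((MulSemiringAction.toRingEquiv (↥(Subgroup.zpowers σ)) (MvPolynomial (Fin n) k) g⁻¹ :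
          MvPolynomial (Fin n) k ≃+* MvPolynomial (Fin n) k) :
            MvPolynomial (Fin n) k →+* MvPolynomial (Fin n) k))))
      (hJ : (∀ g : ↥(Subgroup.zpowers σ),
        (affineBlowup.idealSheaf I4).comap (ρ g).hom = affineBlowup.idealSheaf I4)) (g : ↥(Subgroup.zpowers σ)) (v : ↥(affineBlowup I4))
      (hv : (((affineBlowup.isBlowup I4).liftAction ρ hJ) g).hom.base v = v), v ∈ VchD →
      (Ideal.span (Set.range fun s =>
        ((affineBlowup I4).presheaf.stalkSpecializes (specializes_of_eq hv) ≫
          (((affineBlowup.isBlowup I4).liftAction ρ hJ) g).hom.stalkMap v).hom s - s)).IsPrincipal)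
    (HPa : ∀ (ρ : ↥(Subgroup.zpowers σ) →* Aut (Spec (CommRingCat.of (MvPolynomial (Fin n) k))))
      (_ : (∀ g : ↥(Subgroup.zpowers σ), (ρ g).hom = Spec.map (CommRingCat.ofHom
        ((MulSemiringAction.toRingEquiv (↥(Subgroup.zpowers σ)) (MvPolynomial (Fin n) k) g⁻¹ :
          MvPolynomial (Fin n) k ≃+* MvPolynomial (Fin n) k) :
            MvPolynomial (Fin n) k →+* MvPolynomial (Fin n) k))))
      (hJ : (∀ g : ↥(Subgroup.zpowers σ),
        (affineBlowup.idealSheaf I4).comap (ρ g).hom = affineBlowup.idealSheaf I4))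
      (ρB : ActionOver (affineBlowup.π I4 ≫ qσ σ) ↥(Subgroup.zpowers σ))
      (_ : ρB.aut = (affineBlowup.isBlowup I4).liftAction ρ hJ)
      (Oa : ρB.StableAffineOpens) (_ : Oa.1 = VchA)
      (Za : Closeds (ρB.pieceQuot Oa)),
      (Za : Set (ρB.pieceQuot Oa)) = (ρB.pieceMk Oa).base '' (Oa.1.ι.base ⁻¹' Ta) →
      ∀ (B' : Scheme.{0}) (pB : B' ⟶ ρB.pieceQuot Oa),
        IsBlowup pB (Scheme.IdealSheafData.vanishingIdeal Za) → Scheme.IsRegular B') :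
    Scheme.HasResolution
      (Spec (.of (FixedPoints.subalgebra k (MvPolynomial (Fin n) k) (Subgroup.zpowers σ)))) := by
  classical
  haveI : Fact (Nat.Prime p) := ⟨hp⟩
  have hσp : σ ^ p = 1 :=
    pow_prime_eq_one k n σ a b c d e hab hac hae hbd hcd hde hb hc he hσ p hp hp3
  have hcard : Nat.card (Subgroup.zpowers σ) = p := by
    rw [Nat.card_zpowers, orderOf_eq_prime hσp (JordanThree.ne_one k n σ a b hb)]
  have ha : σ (X a) = X a := hσ a hab hac hae
  have hn : 0 < n := Fin.pos a
  -- the rings: `S = k[x]`, `G = ⟨σ⟩`, `A = S^G`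
  let S : Type := MvPolynomial (Fin n) k
  let G : Type := ↥(Subgroup.zpowers σ)
  let A : Subalgebra k S := FixedPoints.subalgebra k S G
  -- the action on `𝔸ⁿ`
  obtain ⟨ρ, hρ⟩ := AffineQuotient.exists_specAction S G
  -- the quotient data
  let fk : Spec (.of A) ⟶ Spec (.of k) := Spec.map (CommRingCat.ofHom (algebraMap k A))
  let q : Spec (.of S) ⟶ Spec (.of A) := Spec.map (CommRingCat.ofHom (algebraMap A S))
  haveI : LocallyOfFiniteType fk := AffineQuotient.locallyOfFiniteType_specMap_fixedPoints k
  haveI : IsFinite q := AffineQuotient.isFinite_specMap_fixedPoints k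
  have hsurj : Function.Surjective q.base := AffineQuotient.surjective_specMap_fixedPoints k
  have hρq : ∀ g : G, (ρ g).hom ≫ q = q := AffineQuotient.specAction_comp k ρ hρ
  have horb : ∀ x y : Spec (CommRingCat.of S), q.base x = q.base y →
      ∃ g : G, (ρ g).hom.base x = y :=
    fun x y hxy => AffineQuotient.exists_specAction_base_eq k ρ hρ x y hxy
  -- faithfulness of `ρ`
  have hfaith : Function.Injective ρ := by
    intro g h hgh
    have h1 : (ρ g).hom = (ρ h).hom := by rw [hgh]
    rw [hρ, hρ] at h1
    have h2 := Spec.map_injective h1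
    have h3 : ∀ x : S, g⁻¹ • x = h⁻¹ • x := fun x => by
      have := congrArg (fun f : CommRingCat.of S ⟶ CommRingCat.of S => f.hom x) h2
      simpa using this
    have h4 : g⁻¹ = h⁻¹ := Subtype.ext (AlgEquiv.ext fun x => h3 x)
    exact inv_injective h4
  -- generically étale: over `D(x_a)`
  have hXa : (X a : S) ∈ A := (TameTransfer.mem_fixedPoints_zpowers_iff_apply_eq σ (X a)).mpr ha
  have ht0 : (⟨X a, hXa⟩ : A) ≠ 0 := fun h =>
    MvPolynomial.X_ne_zero a (congrArg Subtype.val h : ((⟨X a, hXa⟩ : A) : S) = ((0 : A) : S))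
  have hU : ∃ U : (Spec (.of A)).Opens, Dense (U : Set (Spec (.of A))) ∧ Etale (q ∣_ U) :=
    AffineQuotient.exists_dense_etale_morphismRestrict k (⟨X a, hXa⟩ : A) ht0
      fun g hg => LinearSmallBlocks.X_mem_augIdeal_of_transvection k p hp σ a b ha hb hσp g hg
  -- `dim X₁ = n > 0`
  have hdim : ¬ topologicalKrullDim (Spec (CommRingCat.of A)) ≤ 0 := by
    rw [AffineQuotient.topologicalKrullDim_spec_fixedPoints k,
      AffineQuotient.topologicalKrullDim_spec_mvPolynomial k n]
    have hn' : (0 : WithBot ℕ∞) < (n : WithBot ℕ∞) := by exact_mod_cast hn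
    exact not_le.mpr hn'
  -- the model `V = Bl_I 𝔸ⁿ` with the lifted action
  have hπ : IsBlowup (affineBlowup.π I4) (affineBlowup.idealSheaf I4) := affineBlowup.isBlowup I4
  obtain ⟨hVint, hVprop, hbir⟩ := I4_blowup_integral_proper_birational k n a b d
  have hJ : (∀ g : ↥(Subgroup.zpowers σ), (affineBlowup.idealSheaf I4).comap (ρ g).hom = affineBlowup.idealSheaf I4) := idealSheaf_I4_comap k n σ a b c d e hab hac hae hbd hcd hde hb hσ ρ hρ
  have hequiv : ∀ g : G, (hπ.liftAction ρ hJ g).hom ≫ affineBlowup.π I4 =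
      affineBlowup.π I4 ≫ (ρ g).hom := fun g => hπ.liftAction_hom_comp ρ hJ g
  haveI : (Spec (CommRingCat.of A)).IsSeparated := inferInstance
  let ρB : ActionOver (affineBlowup.π I4 ≫ q) G :=
    ⟨hπ.liftAction ρ hJ, fun g => by rw [← Category.assoc, hequiv g, Category.assoc, hρq g]⟩
  -- the three principal charts: cover and stability
  have hxb : ι₀ (g4 1) ∈ (affineBlowup.idealSheaf I4).ideal ⟨⊤, isAffineOpen_top _⟩ :=
    ι_gens_mem_ideal_top k n a b d 1
  have hcov3 : VchA ⊔ VchB ⊔ VchD = ⊤ := chart_a_sup_chart_bsq_sup_chart_dsq_eq_top k n a b d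
  have hA_st : ∀ g : G, (hπ.liftAction ρ hJ g).hom ⁻¹ᵁ VchA = VchA :=
    fun g => preimage_chart_a_eq k n σ a b c d e hab hac hae hσ ρ hρ hJ g
  have hD_st : ∀ g : G, (hπ.liftAction ρ hJ g).hom ⁻¹ᵁ VchD = VchD :=
    fun g => preimage_chart_dsq_eq k n σ a b c d e hbd hcd hde hσ ρ hρ hJ g
  have hAD_st : ∀ g : G, (hπ.liftAction ρ hJ g).hom ⁻¹ᵁ (VchA ⊔ VchD) = VchA ⊔ VchD := by
    intro g
    rw [Scheme.Hom.preimage_sup, hA_st g, hD_st g]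
  have hADB : (VchA ⊔ VchD) ⊔ VchB = ⊤ := by
    rw [eq_top_iff, ← hcov3]
    exact sup_le (sup_le (le_sup_left.trans le_sup_left) le_sup_right)
      (le_sup_right.trans le_sup_left)
  -- the stable affine piece `Ob = ⋂ g·V[x_b²]`
  have hB_aff : IsAffineOpen (VchB) := hπ.isAffineOpen_blowupChart hxb
  obtain ⟨hOb_aff, hOb_st, hOb_le, hcovab⟩ :=
    ToricExit.exists_stable_affine_cover_pair (hπ.liftAction ρ hJ) (VchA ⊔ VchD) (VchB) hAD_st
      hB_aff hADB
  haveI : IsAffine (VchA : Scheme.{0}) := hπ.isAffineOpen_blowupChart (ι_gens_mem_ideal_top k n a b d 0)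
  haveI : IsAffine (VchD : Scheme.{0}) := hπ.isAffineOpen_blowupChart (ι_gens_mem_ideal_top k n a b d 3)
  haveI : IsAffine ((⨅ g : G, (hπ.liftAction ρ hJ g).hom ⁻¹ᵁ VchB : (affineBlowup I4).Opens) :
    Scheme.{0}) := hOb_aff
  let Oa : ρB.StableAffineOpens := ⟨VchA, hA_st, isAffineHom_of_isAffine_of_isSeparated _⟩
  let Od : ρB.StableAffineOpens := ⟨VchD, hD_st, isAffineHom_of_isAffine_of_isSeparated _⟩
  let Ob : ρB.StableAffineOpens :=
    ⟨⨅ g : G, (hπ.liftAction ρ hJ g).hom ⁻¹ᵁ VchB, hOb_st, isAffineHom_of_isAffine_of_isSeparated _⟩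
  have hcov₃ : Oa.1 ⊔ Ob.1 ⊔ Od.1 = ⊤ := by
    rw [eq_top_iff, ← hcovab]
    exact sup_le (sup_le (le_sup_left.trans le_sup_left) le_sup_right)
      (le_sup_right.trans le_sup_left)
  -- `Ob`, `Od` are non-empty (`V` irreducible; the Rees charts `D₊(x_b² t)`, `D₊(x_d² t)` non-empty)
  haveI := hVint
  have hxbI : (X b ^ 2 : S) ∈ I4 := Ideal.subset_span ⟨1, rfl⟩
  have hxdI : (X d ^ 2 : S) ∈ I4 := Ideal.subset_span ⟨3, rfl⟩
  haveI := BlowupExit.nontrivial_away_reesT_of_ne_zero (X b ^ 2 : S) hxbI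
    (pow_ne_zero 2 (X_ne_zero b))
  haveI := BlowupExit.nontrivial_away_reesT_of_ne_zero (X d ^ 2 : S) hxdI
    (pow_ne_zero 2 (X_ne_zero d))
  have hObne : ((Ob.1 : (affineBlowup I4).Opens) : Set ↥(affineBlowup I4)).Nonempty := by
    refine BlowupExit.nonempty_iInf_preimage_of_irreducibleSpace _ (fun g => ?_) _
      (BlowupExit.affineBlowup_blowupChart_nonempty (X b ^ 2 : S) hxbI)
    intro v
    refine ⟨((hπ.liftAction ρ hJ) g).inv.base v, ?_⟩
    rw [← Scheme.Hom.comp_apply, Iso.inv_hom_id]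
    rfl
  have hOdne : ((Od.1 : (affineBlowup I4).Opens) : Set ↥(affineBlowup I4)).Nonempty :=
    BlowupExit.affineBlowup_blowupChart_nonempty (X d ^ 2 : S) hxdI
  -- pieces `b`, `d` are regular
  have hregb : Scheme.IsRegular ((Ob.1 : (affineBlowup I4).Opens) : Scheme.{0}) := fun y => by
    haveI : IsRegularLocalRing ((affineBlowup I4).presheaf.stalk
        ((Ob.1 : (affineBlowup I4).Opens).ι.base y)) := Hregb y.1 (hOb_le y.2)
    exact IsRegularLocalRing.of_ringEquiv
      (asIso ((Ob.1 : (affineBlowup I4).Opens).ι.stalkMap y)).commRingCatIsoToRingEquiv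
  have hregd : Scheme.IsRegular ((Od.1 : (affineBlowup I4).Opens) : Scheme.{0}) := fun y => by
    haveI : IsRegularLocalRing ((affineBlowup I4).presheaf.stalk
        ((Od.1 : (affineBlowup I4).Opens).ι.base y)) := Hregd y.1 y.2
    exact IsRegularLocalRing.of_ringEquiv
      (asIso ((Od.1 : (affineBlowup I4).Opens).ι.stalkMap y)).commRingCatIsoToRingEquiv
  -- the vertex locus
  have hTa : IsClosed Ta :=
    ((PrimeSpectrum.isClosed_zeroLocus _).preimage (affineBlowup.π I4).base.hom.continuous).sdiff
      (Opens.isOpen _)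
  have hTaj : ∀ (j : Fin 4) (_ : j ≠ 0) (v : ↥(affineBlowup I4)), v ∈ Ta →
      v ∉ blowupChart (affineBlowup.π I4) (affineBlowup.idealSheaf I4) ⟨⊤, isAffineOpen_top _⟩
        (ι₀ (g4 j)) := by
    intro j hj v hv hvj
    exact hv.2 (Opens.mem_iSup.mpr ⟨⟨j, hj⟩, hvj⟩)
  have hTa1 : Ta ⊆ ((Oa.1 : (affineBlowup I4).Opens) : Set ↥(affineBlowup I4)) := by
    intro v hv
    have hv' : v ∈ VchA ⊔ VchB ⊔ VchD := by rw [hcov3]; exact Opens.mem_top v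
    rcases Opens.mem_sup.mp hv' with h | h
    · rcases Opens.mem_sup.mp h with h | h
      · exact h
      · exact absurd h (hTaj 1 (by decide) v hv)
    · exact absurd h (hTaj 3 (by decide) v hv)
  have hTa2 : Disjoint Ta ((Ob.1 : (affineBlowup I4).Opens) : Set ↥(affineBlowup I4)) := by
    rw [Set.disjoint_left]
    intro v hv hvb
    exact hTaj 1 (by decide) v hv (hOb_le hvb)
  have hTa3 : Disjoint Ta ((Od.1 : (affineBlowup I4).Opens) : Set ↥(affineBlowup I4)) := by
    rw [Set.disjoint_left]
    intro v hv hvd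
    exact hTaj 3 (by decide) v hv hvd
  -- the exit
  exact ToricExit.toricExitTransfer₁₂ p hp k (Spec (.of S)) (Spec (.of A)) fk q G ρ hcard hfaith hdim
    hsurj hU horb (affineBlowup I4) (affineBlowup.π I4) hbir ρB hequiv Oa Ob Od hcov₃ hObne hregb
    (fun g v hv hvO => Hdivb ρ hρ hJ g v hv (hOb_le hvO)) hOdne hregd
    (fun g v hv hvO => Hdivd ρ hρ hJ g v hv hvO) Ta hTa hTa1 hTa2 hTa3
    (HPa ρ hρ hJ ρB rfl Oa rfl)

end Scaffold

end Summit.ResolutionOfSingularities.ResolutionOfSingularities.Theorems.WildQuotientResolution.JordanThreeTwo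

end
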